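import Mathlib.Analysis.ODE.Basic
import Mathlib.Topology.Connected.Basic
import Mathlib.Analysis.Complex.Basic
import Mathlib.Analysis.Complex.UpperHalfPlane.Topology
import Mathlib.Order.ConditionallyCompleteLattice.Basic
import Literature.Probability.RandomPlanarGeometry.ConformalMap
import HarnessLib

-- provenance: harness21/H21/H21/Prelude/Stoch/LoewnerChain.lean @ 6f9f43a (interim HEAD d8f2665); M5 mechanical rewrite
/-!
# The chordal Loewner chain in the upper half-plane (trunk `Stoch`)

This prelude file formalises the *deterministic* half of the notion `loewner_chain_sle`: the
chordal Loewner evolution in the upper half-plane `ℍₒ` driven by a function `W : ℝ≥0 → ℝ`,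
```
  ∂ₜ gₜ(z) = 2 / (gₜ(z) - W t),   g₀(z) = z,
```
its swallowing times `T_z`, the growing hulls `Kₜ = {z ∈ ℍₒ | T_z ≤ t}`, the conformal maps
`gₜ : ℍₒ \ Kₜ → ℍₒ` with hydrodynamic normalisation `gₜ(z) - z → 0` at `∞`, and the vocabulary
"the chain is generated by a curve `γ`" together with the three phases of the trace
(simple / self-touching / space-filling). The random half (SLE_κ, `W = √κ B`) is in
`Literature.Prelude.Stoch.SLE`.

## Mathlib

We USE Mathlib's ODE predicate `IsIntegralCurveOn` (on `ℂ` viewed as a real normed space),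
`UpperHalfPlane.upperHalfPlaneSet = {z | 0 < z.im}` (notation `ℍₒ`), `connectedComponentIn`,
`Bornology.IsBounded`, `Real.toNNReal`, and the complete linear order `WithTop ℝ≥0` for times
(the index type Mathlib's `MeasureTheory.IsStoppingTime` / `stoppedProcess` expect, so that
`swallowingTime` is directly a candidate stopping time; deliberately NOT `ℝ≥0∞`). Mathlib has no
Loewner theory (`rg -i loewner` only hits the Löwner order on operators). `Literature.Probability.RandomPlanarGeometry.ConformalEquiv`
comes from `Literature.Prelude.Stoch.ConformalMap`.

## Design choices

* Solutions are curves `g : ℝ → ℂ` (junk outside `[0, T)`) that are integral curves of the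
  time-dependent field `vectorField W t z = 2 / (z - W t)` on `{t | 0 ≤ t ∧ ↑t.toNNReal < T}` and
  avoid the singularity `g t ≠ W t`. ONLY the singularity is excluded — there is no `0 < im`
  clause — so real starting points `x ≠ W 0` genuinely flow (on `ℝ`) until they are swallowed;
  `crit-perc.S22` depends on this.
* `swallowingTime W z := sSup {T | ∃ g, IsSolution W z g T}` is `0` when there is no flow at all
  (e.g. `z = W 0`), and `⊤` when the solution is global.
* `map W t z` is defined for every `z : ℂ` by choice from a solution living beyond time `t`, with
  the documented junk value `z` after swallowing.
* The API lemmas whose printed proofs use continuity of the driving function (uniqueness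
  `IsSolution.eqOn`, `IsSolution.im_pos`, `IsGeneratedByCurve.unique`, existence, conformality)
  carry the hypothesis `hW : Continuous W`; purely algebraic facts (`IsSolution.im_eq_zero`,
  `hull_mono`, `hull_scale`) do not.
* "Generated by a curve" and the phase predicates are stated purely topologically via the
  unbounded connected component of `ℍₒ \ γ[0,t]`; "self-touching" is encoded as
  `¬ Injective γ ∧ interior (range γ) = ∅` (architect review 12c).

## References

* G. F. Lawler, *Conformally Invariant Processes in the Plane*, AMS (2005), Ch. 4, §4.1–4.4
  (chordal Loewner equation, hulls, generated by a curve, scaling).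
* S. Rohde, O. Schramm, *Basic properties of SLE*, Ann. of Math. 161 (2005), §2 (phases).
* W. Werner, *Lectures on two-dimensional critical percolation*, IAS/Park City (2007), §3.
-/

open Set Filter Topology Complex
open UpperHalfPlane (upperHalfPlaneSet isOpen_upperHalfPlaneSet)
open scoped NNReal

noncomputable section

namespace Literature.Probability.RandomPlanarGeometry

namespace Loewner

/-! ### The Loewner ODE and its solutions -/

/-- The (time-dependent) **chordal Loewner vector field** on `ℂ` driven by `W : ℝ≥0 → ℝ`:
`vectorField W t z = 2 / (z - W t)` (with `t : ℝ` clamped to `ℝ≥0` via `Real.toNNReal`; junk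
value `0` at the singularity `z = W t` by `x / 0 = 0`, never used since solutions avoid it).
Lawler (2005), Ch. 4, eq. (4.4). [cite: Lawler2005] -/
def vectorField (W : ℝ≥0 → ℝ) (t : ℝ) (z : ℂ) : ℂ :=
  2 / (z - W t.toNNReal)

/-- Unfolding lemma for `vectorField`. [folklore] -/
theorem vectorField_apply (W : ℝ≥0 → ℝ) (t : ℝ) (z : ℂ) :
    vectorField W t z = 2 / (z - W t.toNNReal) := rfl

/-- `IsSolution W z g T`: the curve `g : ℝ → ℂ` solves the chordal Loewner equation
`ġ t = 2 / (g t - W t)` started at `g 0 = z` on the time interval `[0, T)` (`T : WithTop ℝ≥0`,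
possibly `⊤`), staying away from the singularity: `g t ≠ W t` for `0 ≤ t < T`. Uses Mathlib's
`IsIntegralCurveOn` on `ℂ` as a real normed space. No condition `0 < im (g t)` is imposed, so
real points `x ≠ W 0` flow on the real line until swallowed. Lawler (2005), Ch. 4, §4.1. [cite: Lawler2005] -/
def IsSolution (W : ℝ≥0 → ℝ) (z : ℂ) (g : ℝ → ℂ) (T : WithTop ℝ≥0) : Prop :=
  g 0 = z ∧ IsIntegralCurveOn g (vectorField W) {t : ℝ | 0 ≤ t ∧ (t.toNNReal : WithTop ℝ≥0) < T} ∧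
    ∀ t : ℝ, 0 ≤ t → (t.toNNReal : WithTop ℝ≥0) < T → g t ≠ W t.toNNReal

/-- The **swallowing time** `T_z ∈ [0, ∞]` of a point `z : ℂ` under the Loewner flow driven by
`W`: the supremum of the lifetimes `T` of solutions started at `z`. It is `0` when there is no
flow at all (e.g. `z = W 0`; also, as a junk case, for wild `W` admitting no solution) and `⊤`
when the solution is global. The set `{T | ∃ g, IsSolution W z g T}` is downward closed
(`IsSolution.mono`), so the `sSup` is the true lifetime of the maximal flow. Valued in
`WithTop ℝ≥0` (a `CompleteLinearOrder`). Lawler (2005), Ch. 4, §4.1 (`T_z`). [cite: Lawler2005] -/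
def swallowingTime (W : ℝ≥0 → ℝ) (z : ℂ) : WithTop ℝ≥0 :=
  sSup {T | ∃ g, IsSolution W z g T}

/-- The **Loewner hull** at time `t`: `Kₜ = {z ∈ ℍₒ | T_z ≤ t}`, the set of points of the open
upper half-plane swallowed by time `t`. Lawler (2005), Ch. 4, §4.1 (`Kₜ`). [cite: Lawler2005] -/
def hull (W : ℝ≥0 → ℝ) (t : ℝ≥0) : Set ℂ :=
  {z ∈ upperHalfPlaneSet | swallowingTime W z ≤ t}

/-- The **Loewner domain** at time `t`: `Hₜ = ℍₒ \ Kₜ = {z ∈ ℍₒ | t < T_z}`, the set of points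
still flowing at time `t`. Lawler (2005), Ch. 4, §4.1 (`Hₜ`). [cite: Lawler2005] -/
def domain (W : ℝ≥0 → ℝ) (t : ℝ≥0) : Set ℂ :=
  upperHalfPlaneSet \ hull W t

open Classical in
/-- The **Loewner map** `gₜ : ℂ → ℂ`: for `z` admitting a solution `g` of the Loewner equation
living beyond time `t`, `map W t z = g t` (well defined for continuous `W` by uniqueness,
`IsSolution.eqOn`; for general `W` it is a choice among solutions); otherwise (i.e. after `z`
has been swallowed, `T_z ≤ t`, or when there is no flow) the documented junk value `z`.
Defined for all `z : ℂ`, in particular for real `z`. On `domain W t` it is the conformal map `Hₜ → ℍₒ` (`exists_conformalEquiv_map`). Lawler (2005), Ch. 4, §4.1 (`gₜ`). [cite: Lawler2005] -/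
def map (W : ℝ≥0 → ℝ) (t : ℝ≥0) (z : ℂ) : ℂ :=
  if h : ∃ p : (ℝ → ℂ) × WithTop ℝ≥0, IsSolution W z p.1 p.2 ∧ (t : WithTop ℝ≥0) < p.2 then
    h.choose.1 t
  else z

/-! ### Hulls generated by curves; phases of the trace -/

/-- The union of the **unbounded connected components** of a set `U ⊆ ℂ`: the points `z ∈ U` whose
connected component in `U` is not bounded. For `U = ℍₒ \ γ[0,t]` with `γ` a curve in `closure ℍₒ`
this is the unbounded component of the complement of the curve. Lawler (2005), Ch. 4, §4.1;
cf. Mathlib's `connectedComponentIn`, `Bornology.IsBounded`. [cite: Lawler2005] -/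
def unboundedComponent (U : Set ℂ) : Set ℂ :=
  {z ∈ U | ¬ Bornology.IsBounded (connectedComponentIn U z)}

/-- `unboundedComponent U ⊆ U`. [folklore] -/
theorem unboundedComponent_subset (U : Set ℂ) : unboundedComponent U ⊆ U :=
  fun _ hz ↦ hz.1

/-- The Loewner chain driven by `W` is **generated by the curve** `γ : ℝ≥0 → closure ℍₒ`:
`γ` is continuous, starts at `γ 0 = W 0`, stays in the closed upper half-plane, and for every
`t` the hull `Kₜ` is the complement in `ℍₒ` of the unbounded connected component of
`ℍₒ \ γ[0, t]`. Lawler (2005), Ch. 4, §4.1 (chains generated by a curve);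
Rohde–Schramm (2005), §1. [cite: Lawler2005] -/
def IsGeneratedByCurve (W : ℝ≥0 → ℝ) (γ : ℝ≥0 → ℂ) : Prop :=
  Continuous γ ∧ γ 0 = W 0 ∧ (∀ t, 0 ≤ (γ t).im) ∧
    ∀ t, hull W t = upperHalfPlaneSet \ unboundedComponent (upperHalfPlaneSet \ γ '' Icc 0 t)

open Classical in
/-- The **Loewner trace** `γ : ℝ≥0 → ℂ` of the chain driven by `W`: the generating curve when the
chain is generated by a curve (unique, `IsGeneratedByCurve.unique`), and the documented junk
constant curve `fun _ ↦ W 0` otherwise. Lawler (2005), Ch. 4, §4.1; Rohde–Schramm (2005), §1. [cite: Lawler2005] -/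
def trace (W : ℝ≥0 → ℝ) : ℝ≥0 → ℂ :=
  if h : ∃ γ, IsGeneratedByCurve W γ then h.choose else fun _ ↦ (W 0 : ℂ)

/-- Phase predicate: the curve `γ : ℝ≥0 → ℂ` is a **simple trace**, i.e. injective and contained
in the open upper half-plane for positive times (the SLE_κ phase `κ ≤ 4`).
Rohde–Schramm (2005), Thm 6.1 / §1. [cite: RohdeSchramm2005] -/
def IsSimpleTrace (γ : ℝ≥0 → ℂ) : Prop :=
  Function.Injective γ ∧ ∀ t, 0 < t → 0 < (γ t).im

/-- Phase predicate: the curve `γ : ℝ≥0 → ℂ` is **space-filling**, i.e. its range is the whole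
closed upper half-plane (the SLE_κ phase `κ ≥ 8`). Rohde–Schramm (2005), Thm 7.9 / §1. [cite: RohdeSchramm2005] -/
def IsSpaceFilling (γ : ℝ≥0 → ℂ) : Prop :=
  range γ = closure upperHalfPlaneSet

/-- Phase predicate: the curve `γ : ℝ≥0 → ℂ` is **self-touching**: it is not injective (it hits
itself or the real line again) but its range has empty interior (it is not space-filling). This
is the encoding chosen for the SLE_κ phase `4 < κ < 8` (architect review 12c); it records the two
topological features separating this phase from the other two. Rohde–Schramm (2005), §1, §6. [cite: RohdeSchramm2005] -/
def IsSelfTouching (γ : ℝ≥0 → ℂ) : Prop :=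
  ¬ Function.Injective γ ∧ interior (range γ) = ∅

/-! ### API: existence, uniqueness and invariance of the flow -/

section Flow

variable {W : ℝ≥0 → ℝ} {z : ℂ} {g g' : ℝ → ℂ} {T T' : WithTop ℝ≥0}

/-- A solution starts at `z`. [folklore] -/
theorem IsSolution.apply_zero (h : IsSolution W z g T) : g 0 = z := h.1

/-- A solution is an integral curve of the Loewner vector field on `[0, T)`. [folklore] -/
theorem IsSolution.isIntegralCurveOn (h : IsSolution W z g T) :
    IsIntegralCurveOn g (vectorField W) {t : ℝ | 0 ≤ t ∧ (t.toNNReal : WithTop ℝ≥0) < T} :=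
  h.2.1

/-- A solution avoids the singularity: `g t ≠ W t` on `[0, T)`. [folklore] -/
theorem IsSolution.ne (h : IsSolution W z g T) {t : ℝ} (ht : 0 ≤ t)
    (htT : (t.toNNReal : WithTop ℝ≥0) < T) : g t ≠ W t.toNNReal :=
  h.2.2 t ht htT

/-- Restricting the lifetime of a solution gives a solution. [folklore] -/
theorem IsSolution.mono (h : IsSolution W z g T) (hT : T' ≤ T) : IsSolution W z g T' :=
  ⟨h.1, h.2.1.mono fun _ ht ↦ ⟨ht.1, ht.2.trans_le hT⟩,
    fun t ht htT ↦ h.2.2 t ht (htT.trans_le hT)⟩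

/-- The lifetime of a solution is bounded by the swallowing time. [folklore] -/
theorem IsSolution.le_swallowingTime (h : IsSolution W z g T) : T ≤ swallowingTime W z :=
  le_sSup ⟨g, h⟩

/-- **Existence of the maximal solution.** For a continuous driving function and a starting point
off the singularity, the Loewner equation has a solution defined up to the swallowing time `T_z`
(Picard–Lindelöf for the locally Lipschitz field `2 / (z - W t)`, patched along `[0, T_z)`).
Lawler (2005), Ch. 4, §4.1 (existence/uniqueness of the chordal Loewner flow). [cite: Lawler2005] -/
def exists_isSolution_swallowingTime : Prop :=
  ∀ (hW : Continuous W) (hz : z ≠ W 0),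
    ∃ g, IsSolution W z g (swallowingTime W z)

/-- **Uniqueness of solutions.** Two solutions of the Loewner equation started at the same point
agree on their common interval of definition (for continuous `W` the field `2 / (z - W t)` is
continuous and locally Lipschitz in `z` away from the singularity; Grönwall, cf. Mathlib's
`ODE_solution_unique_of_mem_isOpen`). Continuity of `W` is essential here.
Lawler (2005), Ch. 4, §4.1 (existence/uniqueness of the chordal Loewner flow). [cite: Lawler2005] -/
def IsSolution.eqOn : Prop :=
  ∀ (hW : Continuous W) (h : IsSolution W z g T) (h' : IsSolution W z g' T'),
    EqOn g g' {t : ℝ | 0 ≤ t ∧ (t.toNNReal : WithTop ℝ≥0) < min T T'}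

/-- For a continuous driving function, a solution started in the open upper half-plane stays in
it: `y = im g` satisfies `y' = -(|g'|² / 2) y` with `|g'|` locally bounded (as `|g - W|` is bounded
below on compacts by continuity), so `y` is decreasing but positive on `[0, T)`. (False without
continuity of `W`.) Lawler (2005), Ch. 4, §4.1 (remark after eq. (4.4)). [cite: Lawler2005] -/
def IsSolution.im_pos : Prop :=
  ∀ (hW : Continuous W) (h : IsSolution W z g T) (hz : 0 < z.im),
    ∀ t : ℝ, 0 ≤ t → (t.toNNReal : WithTop ℝ≥0) < T → 0 < (g t).im

/-- A solution started on the real line stays real (the field is real on `ℝ`; uniqueness).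
Lawler (2005), Ch. 4, §4.1 (existence/uniqueness of the chordal Loewner flow). [cite: Lawler2005] -/
def IsSolution.im_eq_zero : Prop :=
  ∀ (h : IsSolution W z g T) (hz : z.im = 0),
    ∀ t : ℝ, 0 ≤ t → (t.toNNReal : WithTop ℝ≥0) < T → (g t).im = 0

/-- For a continuous driving function every point `z ≠ W 0` flows for a positive time:
`0 < T_z`. Lawler (2005), Ch. 4, §4.1 (existence of the chordal Loewner flow). [cite: Lawler2005] -/
def swallowingTime_pos : Prop :=
  ∀ (hW : Continuous W) (hz : z ≠ W 0),
    0 < swallowingTime W z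

end Flow

/-! ### API: hulls and Loewner maps -/

section Hull

variable {W : ℝ≥0 → ℝ}

/-- The hulls `Kₜ` increase with `t` (immediate from the definition). Lawler (2005), Ch. 4,
§4.1. [cite: Lawler2005] -/
theorem hull_mono (W : ℝ≥0 → ℝ) : Monotone (hull W) :=
  fun _ _ hst _ hz ↦ ⟨hz.1, hz.2.trans (WithTop.coe_le_coe.2 hst)⟩

/-- `hull W t ⊆ ℍₒ`. [folklore] -/
theorem hull_subset (W : ℝ≥0 → ℝ) (t : ℝ≥0) : hull W t ⊆ upperHalfPlaneSet :=
  fun _ hz ↦ hz.1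

/-- `domain W t ⊆ ℍₒ`. [folklore] -/
theorem domain_subset (W : ℝ≥0 → ℝ) (t : ℝ≥0) : domain W t ⊆ upperHalfPlaneSet :=
  sdiff_subset

/-- Membership in the Loewner domain: `z ∈ Hₜ ↔ z ∈ ℍₒ ∧ t < T_z`. [folklore] -/
theorem mem_domain_iff (W : ℝ≥0 → ℝ) (t : ℝ≥0) (z : ℂ) :
    z ∈ domain W t ↔ z ∈ upperHalfPlaneSet ∧ (t : WithTop ℝ≥0) < swallowingTime W z := by
  simp only [domain, hull, Set.mem_sdiff, mem_setOf_eq, not_and, not_le]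
  exact ⟨fun h ↦ ⟨h.1, h.2 h.1⟩, fun h ↦ ⟨h.1, fun _ ↦ h.2⟩⟩

/-- At time `0` the hull is empty (every `z ∈ ℍₒ` flows for a positive time,
`swallowingTime_pos`). Lawler (2005), Ch. 4, §4.1. [cite: Lawler2005] -/
def hull_zero : Prop :=
  ∀ (hW : Continuous W),
    hull W 0 = ∅

/-- **The Loewner map is a conformal map onto `ℍₒ`.** For a continuous driving function,
`gₜ = map W t` restricted to `Hₜ = ℍₒ \ Kₜ` is a conformal equivalence `Hₜ → ℍₒ`.
Lawler (2005), Ch. 4, §4.1 (the maps `gₜ : Hₜ → ℍ` are conformal transformations). [cite: Lawler2005] -/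
def exists_conformalEquiv_map : Prop :=
  ∀ (hW : Continuous W) (t : ℝ≥0),
    ∃ φ : ConformalEquiv (domain W t) upperHalfPlaneSet, EqOn φ (map W t) (domain W t)

/-- **Hydrodynamic normalisation.** For a continuous driving function, `gₜ(z) - z → 0` as
`z → ∞` in `ℍₒ`; more precisely `gₜ(z) = z + 2t/z + O(|z|⁻²)`, i.e. the half-plane capacity of
`Kₜ` is `2t`. Lawler (2005), Ch. 4, §4.1 (hydrodynamic normalisation, `hcap Kₜ = 2t`). [cite: Lawler2005] -/
def tendsto_map_sub_self : Prop :=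
  ∀ (hW : Continuous W) (t : ℝ≥0),
    Tendsto (fun z ↦ map W t z - z) (cocompact ℂ ⊓ 𝓟 upperHalfPlaneSet) (𝓝 0)

/-- **Brownian-type scaling of Loewner chains.** For `c > 0` the chain driven by the rescaled
function `s ↦ c W(s / c²)` has hulls `c · K_{t/c²}`. Lawler (2005), Ch. 4, §4.1
(scaling rule); this is the deterministic input to the scale invariance of SLE. [cite: Lawler2005] -/
def hull_scale : Prop :=
  ∀ (W : ℝ≥0 → ℝ) (c : ℝ≥0) (hc : c ≠ 0) (t : ℝ≥0),
    hull (fun s ↦ c * W (s / c ^ 2)) t = (fun z ↦ (c : ℂ) * z) '' hull W (t / c ^ 2)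

end Hull

/-! ### API: the trace -/

section Trace

variable {W : ℝ≥0 → ℝ} {γ γ' : ℝ≥0 → ℂ}

/-- A generating curve is continuous. [folklore] -/
theorem IsGeneratedByCurve.continuous (h : IsGeneratedByCurve W γ) : Continuous γ := h.1

/-- A generating curve starts at the driving point `W 0`. [folklore] -/
theorem IsGeneratedByCurve.apply_zero (h : IsGeneratedByCurve W γ) : γ 0 = W 0 := h.2.1

/-- A generating curve lies in the closed upper half-plane. [folklore] -/
theorem IsGeneratedByCurve.im_nonneg (h : IsGeneratedByCurve W γ) (t : ℝ≥0) : 0 ≤ (γ t).im :=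
  h.2.2.1 t

/-- The hulls of a chain generated by `γ` are the sets filled in by `γ[0, t]`. [folklore] -/
theorem IsGeneratedByCurve.hull_eq (h : IsGeneratedByCurve W γ) (t : ℝ≥0) :
    hull W t = upperHalfPlaneSet \ unboundedComponent (upperHalfPlaneSet \ γ '' Icc 0 t) :=
  h.2.2.2 t

/-- **Uniqueness of the generating curve** (continuous driving function): the increasing family
of hulls determines the curve
(`γ t` is the unique point where `K_{t+ε} \ Kₜ` shrinks as `ε → 0`; equivalently
`γ t = lim_{y ↓ 0} gₜ⁻¹ (W t + i y)`). Lawler (2005), Ch. 4, §4.1; Rohde–Schramm (2005), §1. [cite: Lawler2005] -/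
def IsGeneratedByCurve.unique : Prop :=
  ∀ (hW : Continuous W) (h : IsGeneratedByCurve W γ) (h' : IsGeneratedByCurve W γ'),
    γ = γ'

/-- When the chain is generated by some curve, `trace W` is a generating curve. [folklore] -/
theorem isGeneratedByCurve_trace (h : ∃ γ, IsGeneratedByCurve W γ) :
    IsGeneratedByCurve W (trace W) := by
  rw [trace, dif_pos h]
  exact h.choose_spec

/-- When the chain (with continuous driving function) is generated by `γ`, the trace is `γ`. [folklore] -/
def IsGeneratedByCurve.trace_eq : Prop :=
  ∀ (hW : Continuous W) (h : IsGeneratedByCurve W γ),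
    trace W = γ

/- interim proof relied on results that are now named facts (D-0014); demoted to a fact by the M5 import, proof preserved:
:=
  (isGeneratedByCurve_trace ⟨γ, h⟩).unique hW h
-/

/-- The trace starts at the driving point `W 0` (also in the junk case, by design). [folklore] -/
@[simp] theorem trace_zero (W : ℝ≥0 → ℝ) : trace W 0 = W 0 := by
  by_cases h : ∃ γ, IsGeneratedByCurve W γ
  · exact (isGeneratedByCurve_trace h).apply_zero
  · rw [trace, dif_neg h]

end Trace

/-! ### Discharge: Brownian-type scaling of the Loewner flow, swallowing times and hulls -/

section Scale

variable {W : ℝ≥0 → ℝ} {z : ℂ} {g : ℝ → ℂ} {T : WithTop ℝ≥0} {c : ℝ≥0}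

/-- `(t / k)⁺ = t⁺ / k` for `k ≥ 0` (`Real.toNNReal` commutes with division by a nonnegative
constant). [folklore] -/
theorem toNNReal_div_coe (t : ℝ) (k : ℝ≥0) : (t / k).toNNReal = t.toNNReal / k := by
  rcases le_or_gt 0 t with ht | ht
  · apply NNReal.eq
    rw [NNReal.coe_div, Real.coe_toNNReal _ ht,
      Real.coe_toNNReal _ (div_nonneg ht (NNReal.coe_nonneg k))]
  · rw [Real.toNNReal_of_nonpos ht.le, zero_div]
    rcases eq_or_ne k 0 with rfl | hk
    · simp
    · exact Real.toNNReal_of_nonpos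
        (div_nonpos_of_nonpos_of_nonneg ht.le k.2)

/-- In `WithTop ℝ≥0`: `↑(x / k) < T ↔ ↑x < k T` for `k ≠ 0`. [folklore] -/
theorem coe_div_lt_iff_lt_mul {k : ℝ≥0} (hk : k ≠ 0) (x : ℝ≥0) (T : WithTop ℝ≥0) :
    ((x / k : ℝ≥0) : WithTop ℝ≥0) < T ↔ (x : WithTop ℝ≥0) < k * T := by
  induction T with
  | top =>
    rw [WithTop.mul_top (WithTop.coe_ne_zero.2 hk)]
    exact iff_of_true (WithTop.coe_lt_top _) (WithTop.coe_lt_top _)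
  | coe y =>
    rw [← WithTop.coe_mul, WithTop.coe_lt_coe, WithTop.coe_lt_coe,
      div_lt_iff₀ (pos_iff_ne_zero.2 hk), mul_comm]

/-- In `WithTop ℝ≥0`: `k τ ≤ ↑t ↔ τ ≤ ↑(t / k)` for `k ≠ 0`. [folklore] -/
theorem mul_le_coe_iff_le_coe_div {k : ℝ≥0} (hk : k ≠ 0) (τ : WithTop ℝ≥0) (t : ℝ≥0) :
    (k : WithTop ℝ≥0) * τ ≤ t ↔ τ ≤ ((t / k : ℝ≥0) : WithTop ℝ≥0) := by
  induction τ with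
  | top =>
    rw [WithTop.mul_top (WithTop.coe_ne_zero.2 hk)]
    exact iff_of_false (WithTop.top_le_iff.not.2 WithTop.coe_ne_top)
      (WithTop.top_le_iff.not.2 WithTop.coe_ne_top)
  | coe x =>
    rw [← WithTop.coe_mul, WithTop.coe_le_coe, WithTop.coe_le_coe,
      le_div_iff₀ (pos_iff_ne_zero.2 hk), mul_comm]

/-- **Scaling of solutions of the Loewner equation.** If `g` solves the Loewner equation driven by
`W` from `z` on `[0, T)`, then `t ↦ c g(t / c²)` solves the equation driven by `s ↦ c W(s / c²)`
from `c z` on `[0, c² T)` (`c > 0`): the chain rule, `∂ₜ (c g(t/c²)) = c⁻¹ ġ(t/c²)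
= 2 / (c g(t/c²) - c W(t/c²))`. Lawler (2005), Ch. 4, §4.1 (scaling rule) and proof of
Prop. 6.5. [cite: Lawler2005] -/
theorem IsSolution.scale (hc : c ≠ 0) (h : IsSolution W z g T) :
    IsSolution (fun s ↦ (c : ℝ) * W (s / c ^ 2)) ((c : ℂ) * z)
      (fun t ↦ (c : ℂ) * g (t / (c : ℝ) ^ 2)) ((c ^ 2 : ℝ≥0) * T) := by
  have hc' : (0 : ℝ) < c := NNReal.coe_pos.2 (pos_iff_ne_zero.2 hc)
  have hc2 : (0 : ℝ) < (c : ℝ) ^ 2 := by positivity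
  have hcc : (c : ℂ) ≠ 0 := by exact_mod_cast hc
  -- time change `t ↦ t / c²` maps `[0, c² T)` into `[0, T)`
  have hnn : ∀ t : ℝ, (t / (c : ℝ) ^ 2).toNNReal = t.toNNReal / c ^ 2 := fun t ↦ by
    rw [← NNReal.coe_pow]
    exact toNNReal_div_coe t (c ^ 2)
  have hmaps : MapsTo (fun t : ℝ ↦ t / (c : ℝ) ^ 2)
      {t : ℝ | 0 ≤ t ∧ (t.toNNReal : WithTop ℝ≥0) < (c ^ 2 : ℝ≥0) * T}
      {t : ℝ | 0 ≤ t ∧ (t.toNNReal : WithTop ℝ≥0) < T} := by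
    rintro t ⟨ht0, htT⟩
    refine ⟨div_nonneg ht0 hc2.le, ?_⟩
    rwa [hnn, coe_div_lt_iff_lt_mul (pow_ne_zero 2 hc)]
  refine ⟨by simp [h.apply_zero], fun t ht ↦ ?_, fun t ht0 htT ↦ ?_⟩
  · -- chain rule
    have hs := hmaps ht
    have h1 : HasDerivWithinAt (fun t : ℝ ↦ t / (c : ℝ) ^ 2) (1 / (c : ℝ) ^ 2)
        {t : ℝ | 0 ≤ t ∧ (t.toNNReal : WithTop ℝ≥0) < (c ^ 2 : ℝ≥0) * T} t := by
      simpa using (hasDerivWithinAt_id t _).div_const ((c : ℝ) ^ 2)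
    have h2 := (HasDerivWithinAt.scomp t (h.isIntegralCurveOn _ hs) h1 hmaps).const_mul (c : ℂ)
    refine h2.congr_deriv ?_
    simp only [vectorField_apply, hnn, Complex.real_smul]
    push_cast
    field_simp
  · -- off the singularity
    have hs := hmaps ⟨ht0, htT⟩
    have hne := h.ne hs.1 hs.2
    rw [hnn] at hne
    push_cast
    intro heq
    exact hne (mul_left_cancel₀ hcc heq)

/-- Converse scaling: a solution for the rescaled data comes from a solution for the original data
(apply `IsSolution.scale` with `c⁻¹`). Lawler (2005), Ch. 4, §4.1. [cite: Lawler2005] -/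
theorem IsSolution.of_scale (hc : c ≠ 0) {g' : ℝ → ℂ} {T' : WithTop ℝ≥0}
    (h : IsSolution (fun s ↦ (c : ℝ) * W (s / c ^ 2)) ((c : ℂ) * z) g' T') :
    IsSolution W z (fun t ↦ ((c⁻¹ : ℝ≥0) : ℂ) * g' (t / ((c⁻¹ : ℝ≥0) : ℝ) ^ 2))
      ((c⁻¹ ^ 2 : ℝ≥0) * T') := by
  have hcc : (c : ℂ) ≠ 0 := by exact_mod_cast hc
  have := h.scale (inv_ne_zero hc)
  convert this using 2
  · symm
    rw [inv_pow, div_inv_eq_mul, mul_div_assoc, div_self (pow_ne_zero 2 hc), mul_one,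
      NNReal.coe_inv, inv_mul_cancel_left₀ (NNReal.coe_ne_zero.2 hc)]
  · push_cast
    rw [inv_mul_cancel_left₀ hcc]

/-- **Scaling of swallowing times**: `T_{c z}` for the driving function `s ↦ c W(s / c²)` is
`c² T_z` (`c > 0`). Lawler (2005), Ch. 4, §4.1 (scaling rule). [cite: Lawler2005] -/
theorem swallowingTime_scale (hc : c ≠ 0) (W : ℝ≥0 → ℝ) (z : ℂ) :
    swallowingTime (fun s ↦ (c : ℝ) * W (s / c ^ 2)) ((c : ℂ) * z) =
      ((c ^ 2 : ℝ≥0) : WithTop ℝ≥0) * swallowingTime W z := by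
  set e : WithTop ℝ≥0 ≃o WithTop ℝ≥0 :=
    (OrderIso.mulLeft₀ (c ^ 2) (pos_iff_ne_zero.2 (pow_ne_zero 2 hc))).withTopCongr with he_def
  have he : ∀ T : WithTop ℝ≥0, e T = ((c ^ 2 : ℝ≥0) : WithTop ℝ≥0) * T := by
    intro T
    induction T with
    | top =>
      rw [WithTop.mul_top (WithTop.coe_ne_zero.2 (pow_ne_zero 2 hc))]
      rfl
    | coe x =>
      rw [he_def, OrderIso.withTopCongr_apply, WithTop.map_coe, ← WithTop.coe_mul]
      rfl
  have hset : {T' | ∃ g', IsSolution (fun s ↦ (c : ℝ) * W (s / c ^ 2)) ((c : ℂ) * z) g' T'} =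
      e '' {T | ∃ g, IsSolution W z g T} := by
    ext T'
    constructor
    · rintro ⟨g', hg'⟩
      refine ⟨(c⁻¹ ^ 2 : ℝ≥0) * T', ⟨_, hg'.of_scale hc⟩, ?_⟩
      rw [he, ← mul_assoc, ← WithTop.coe_mul, ← mul_pow, mul_inv_cancel₀ hc, one_pow,
        WithTop.coe_one, one_mul]
    · rintro ⟨T, ⟨g, hg⟩, rfl⟩
      exact ⟨_, (he T).symm ▸ hg.scale hc⟩
  unfold swallowingTime
  rw [hset, ← he, OrderIso.map_sSup, sSup_image]

/-- **Brownian-type scaling of Loewner hulls** (`hull_scale`) holds: the chain driven by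
`s ↦ c W(s / c²)` has hulls `c · K_{t/c²}` — from the scaling of solutions and swallowing times.
Lawler (2005), Ch. 4, §4.1 (scaling rule). [cite: Lawler2005] -/
theorem hull_scale_holds : hull_scale := by
  intro W c hc t
  have hcc : (c : ℂ) ≠ 0 := by exact_mod_cast hc
  ext w
  constructor
  · rintro ⟨hw, hT⟩
    refine ⟨(c : ℂ)⁻¹ * w, ⟨?_, ?_⟩, by simp [hcc]⟩
    · change 0 < (((c : ℂ))⁻¹ * w).im
      rw [← Complex.ofReal_inv, Complex.im_ofReal_mul]
      exact mul_pos (inv_pos.2 (NNReal.coe_pos.2 (pos_iff_ne_zero.2 hc))) hw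
    · have h1 : swallowingTime (fun s ↦ (c : ℝ) * W (s / c ^ 2)) ((c : ℂ) * ((c : ℂ)⁻¹ * w)) ≤ t := by
        rwa [mul_inv_cancel_left₀ hcc]
      rw [swallowingTime_scale hc] at h1
      exact (mul_le_coe_iff_le_coe_div (pow_ne_zero 2 hc) _ _).1 h1
  · rintro ⟨u, ⟨hu, hT⟩, rfl⟩
    refine ⟨?_, ?_⟩
    · change 0 < ((c : ℂ) * u).im
      rw [Complex.im_ofReal_mul]
      exact mul_pos (NNReal.coe_pos.2 (pos_iff_ne_zero.2 hc)) hu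
    · change swallowingTime (fun s ↦ (c : ℝ) * W (s / c ^ 2)) ((c : ℂ) * u) ≤ t
      rw [swallowingTime_scale hc]
      exact (mul_le_coe_iff_le_coe_div (pow_ne_zero 2 hc) _ _).2 hT

end Scale

/-! ### Generating curves under dilations; scaling of the trace -/

section GenScale

variable {W : ℝ≥0 → ℝ} {γ : ℝ≥0 → ℂ} {c : ℝ≥0}

/-- Dilations preserve boundedness of sets in `ℂ`. [folklore] -/
theorem isBounded_image_mul_iff {k : ℂ} (hk : k ≠ 0) (s : Set ℂ) :
    Bornology.IsBounded ((fun z ↦ k * z) '' s) ↔ Bornology.IsBounded s := by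
  refine ⟨fun h ↦ ?_, fun h ↦ (lipschitzWith_smul k).isBounded_image h⟩
  have h' := (lipschitzWith_smul k⁻¹).isBounded_image h
  rw [Set.image_image] at h'
  simpa [smul_eq_mul, inv_mul_cancel_left₀ hk] using h'

/-- **Unbounded components are dilation covariant**: `c · unboundedComponent U =
unboundedComponent (c · U)` for `c ≠ 0` (a dilation is a homeomorphism of `ℂ` mapping connected
components to connected components and bounded sets to bounded sets). [folklore] -/
theorem image_mul_unboundedComponent {k : ℂ} (hk : k ≠ 0) (U : Set ℂ) :
    (fun z ↦ k * z) '' unboundedComponent U = unboundedComponent ((fun z ↦ k * z) '' U) := by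
  have hφ : ∀ {x : ℂ}, x ∈ U → (fun z ↦ k * z) '' connectedComponentIn U x =
      connectedComponentIn ((fun z ↦ k * z) '' U) (k * x) :=
    fun hx ↦ (Homeomorph.mulLeft₀ k hk).image_connectedComponentIn hx
  ext w
  simp only [unboundedComponent, mem_image, mem_setOf_eq]
  constructor
  · rintro ⟨x, ⟨hxU, hxb⟩, rfl⟩
    refine ⟨⟨x, hxU, rfl⟩, fun hb ↦ hxb ?_⟩
    rw [← hφ hxU, isBounded_image_mul_iff hk] at hb
    exact hb
  · rintro ⟨⟨x, hxU, rfl⟩, hb⟩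
    refine ⟨x, ⟨hxU, fun hb' ↦ hb ?_⟩, rfl⟩
    rw [← hφ hxU, isBounded_image_mul_iff hk]
    exact hb'

/-- The initial segment `[0, t]` of the time-rescaled curve `s ↦ c γ(s / c²)` is the dilate of
the initial segment `[0, t / c²]` of `γ`. [folklore] -/
theorem image_Icc_scale (hc : c ≠ 0) (γ : ℝ≥0 → ℂ) (t : ℝ≥0) :
    (fun s ↦ (c : ℂ) * γ (s / c ^ 2)) '' Icc 0 t = (fun z ↦ (c : ℂ) * z) '' (γ '' Icc 0 (t / c ^ 2)) := by
  have hc2 : c ^ 2 ≠ 0 := pow_ne_zero 2 hc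
  ext w
  simp only [mem_image, mem_Icc, zero_le, true_and]
  constructor
  · rintro ⟨s, hs, rfl⟩
    exact ⟨γ (s / c ^ 2), ⟨s / c ^ 2, div_le_div_of_nonneg_right hs zero_le, rfl⟩, rfl⟩
  · rintro ⟨_, ⟨u, hu, rfl⟩, rfl⟩
    refine ⟨c ^ 2 * u, ?_, by rw [mul_div_cancel_left₀ _ hc2]⟩
    calc c ^ 2 * u ≤ c ^ 2 * (t / c ^ 2) := mul_le_mul_right hu _
      _ = t := mul_div_cancel₀ _ hc2

/-- **Generating curves are dilation covariant.** If the chain driven by `W` is generated by `γ`,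
then the chain driven by `s ↦ c W(s / c²)` is generated by `s ↦ c γ(s / c²)` (`c > 0`): the hulls
scale by `hull_scale_holds`, and filling in commutes with the dilation `z ↦ c z`, a homeomorphism
of `ℂ` preserving `ℍₒ`. Lawler (2005), Ch. 4, §4.1 (scaling rule); proof of Prop. 6.5. [cite: Lawler2005] -/
theorem IsGeneratedByCurve.scale (hc : c ≠ 0) (h : IsGeneratedByCurve W γ) :
    IsGeneratedByCurve (fun s ↦ (c : ℝ) * W (s / c ^ 2)) (fun s ↦ (c : ℂ) * γ (s / c ^ 2)) := by
  have hcc : (c : ℂ) ≠ 0 := by exact_mod_cast hc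
  have hc' : (0 : ℝ) < c := NNReal.coe_pos.2 (pos_iff_ne_zero.2 hc)
  have hinj : Function.Injective fun z : ℂ ↦ (c : ℂ) * z := mul_right_injective₀ hcc
  have hH : (fun z : ℂ ↦ (c : ℂ) * z) '' upperHalfPlaneSet = upperHalfPlaneSet := by
    ext w
    simp only [mem_image]
    constructor
    · rintro ⟨x, hx, rfl⟩
      change 0 < (((c : ℝ) : ℂ) * x).im
      rw [im_ofReal_mul]
      exact mul_pos hc' hx
    · intro hw
      refine ⟨(c : ℂ)⁻¹ * w, ?_, mul_inv_cancel_left₀ hcc w⟩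
      change 0 < ((((c : ℝ) : ℂ))⁻¹ * w).im
      rw [← ofReal_inv, im_ofReal_mul]
      exact mul_pos (inv_pos.2 hc') hw
  refine ⟨continuous_const.mul (h.continuous.comp (continuous_id.div_const _)),
    by simp [h.apply_zero], fun t ↦ ?_, fun t ↦ ?_⟩
  · change 0 ≤ (((c : ℝ) : ℂ) * γ (t / c ^ 2)).im
    rw [im_ofReal_mul]
    exact mul_nonneg hc'.le (h.im_nonneg _)
  · rw [hull_scale_holds W c hc t, h.hull_eq, image_Icc_scale hc, Set.image_sdiff hinj, hH,
      image_mul_unboundedComponent hcc, Set.image_sdiff hinj, hH]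

/-- **Scaling of the Loewner trace** (given uniqueness of generating curves,
`IsGeneratedByCurve.unique`, hypothesis `hu`): for a continuous driving function `W` whose chain
is generated by a curve, the trace of `s ↦ c W(s / c²)` is `s ↦ c γ(s / c²)`, `γ = trace W`
(`c > 0`). This is the deterministic half of SLE scaling. Lawler (2005), Ch. 4, §4.1 and
Prop. 6.5. [cite: Lawler2005] -/
theorem trace_scale_of_unique
    (hu : ∀ {W : ℝ≥0 → ℝ} {γ γ' : ℝ≥0 → ℂ}, IsGeneratedByCurve.unique (W := W) (γ := γ) (γ' := γ'))
    (hc : c ≠ 0) (hW : Continuous W) (hγ : ∃ γ, IsGeneratedByCurve W γ) :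
    trace (fun s ↦ (c : ℝ) * W (s / c ^ 2)) = fun s ↦ (c : ℂ) * trace W (s / c ^ 2) := by
  have h1 : IsGeneratedByCurve (fun s ↦ (c : ℝ) * W (s / c ^ 2))
      (fun s ↦ (c : ℂ) * trace W (s / c ^ 2)) := (isGeneratedByCurve_trace hγ).scale hc
  have hW' : Continuous fun s : ℝ≥0 ↦ (c : ℝ) * W (s / c ^ 2) := by fun_prop
  exact hu hW' (isGeneratedByCurve_trace ⟨_, h1⟩) h1

end GenScale

end Loewner

end Literature.Probability.RandomPlanarGeometry
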